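import Summits.Ventures.YMGap.RobustBall.ErgodicAverages
import Summits.Ventures.YMGap.RobustBall.SpecificHeatFloor
import Summits.Ventures.YMGap.RobustBall.WilsonOneStateSymmetry
import Summits.Ventures.YMGap.RobustBall.ThermodynamicVariance
import HarnessLib

/-!
# Venture YMGap, track ROBUST-BALL — «C-SING» AT ZERO COUPLING: THE STRONG-COUPLING YANG–MILLS STATE IS SINGULAR WITH RESPECT TO THE FREE (PRODUCT HAAR)
# STATE (`SU(2)` on `ℤ⁴`, tree coupling in `(0, 9/50)`; every `SU(N)` on `ℤ^d` on the 't Hooft single-link window)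

HONEST FRAMING. WHAT THIS IS: a venture file (cell `pub-ymgap`, track Y2 ROBUST-BALL / DS, seat ds-3, theorems only, 0 compute): the companion of
`StatesMutuallySingular` (two POSITIVE couplings) for the pair (`0`, `b`): every DLR state at coupling `0` (the free state: product Haar measure, the unique
DLR state of the zero-coupling specification) and THE DLR state at a coupling `b > 0` of the window are MUTUALLY SINGULAR — in infinite volume the interacting
lattice Yang–Mills measure is NOT absolutely continuous with respect to the free one. Mechanism: almost-sure self-averaging of the plaquette under both states
(`ErgodicAverages`), monotonicity of the mean plaquette on the closed window from `0` (`PressureRegularity.su2_plaquette_monotoneOn` /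
`plaquette_monotoneOn_dim_thooft`) and its STRICT increase between `b/2` and `b` (`EnergyVariance.su2_plaquette_increment_ge` / `plaquette_increment_ge_dim_thooft`).
* ★★★ `su2_state_mutuallySingular_zero` — `SU(2)`, `d = 4`, `0 < b < 9/50`: `μ₀ ⟂ₘ μ` for all DLR states `μ₀ ∈ 𝒢(0)`, `μ ∈ 𝒢(b)`;
* ★★★ `suN_state_mutuallySingular_zero_dim` — every `N ≥ 2`, `d ≥ 2`, 't Hooft `0 < β < min(1/(12(d−1)), 1/(8d))`: `μ₀ ⟂ₘ μ` for all DLR states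
  `μ₀ ∈ 𝒢(0)`, `μ ∈ 𝒢(Nβ)` — HYPOTHESIS-FREE.
WHAT THIS IS NOT: lattice strong coupling; nothing about larger couplings, the continuum limit or Clay. Everything here is proved. [folklore]
-/

noncomputable section

open MeasureTheory ProbabilityTheory Filter Topology Real Finset Set
open scoped NNReal ENNReal
open Literature.Probability.LatticeModels hiding configShift configShift_apply
open Literature.MathematicalPhysics.QuantumLattice
open Literature.MathematicalPhysics.QuantumFieldTheory (zdPlaquetteObs)

namespace Summit.Ventures.YMGap.RobustBall

namespace BoundaryFreeEnergy

/-! ### `SU(2)` on `ℤ⁴` -/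

section SU2

/-- ★★★ **THE STRONG-COUPLING `SU(2)` STATE IS SINGULAR WITH RESPECT TO THE FREE STATE** (`d = 4`, tree coupling `0 < b < 9/50`; `μ₀` any DLR state at
coupling `0` — the product Haar measure — and `μ` any DLR state at `b`, each unique): `μ₀ ⟂ₘ μ`. [folklore] -/
theorem su2_state_mutuallySingular_zero {b : ℝ} (hb0 : 0 < b) (hb : b < 9 / 50)
    {μ₀ μ : Measure (LGConfig 4 (SUN 2))} (hμ₀ : μ₀ ∈ ymGibbsMeasures (d := 4) (fundamentalRep (Fin 2)) 0)
    (hμ : μ ∈ ymGibbsMeasures (d := 4) (fundamentalRep (Fin 2)) b) : μ₀ ⟂ₘ μ := by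
  classical
  have hρc : Continuous (fundamentalRep (Fin 2)) := continuous_fundamentalRep (Fin 2)
  set F : LGConfig 4 (SUN 2) → ℝ := plaquetteObs (fundamentalRep (Fin 2)) 0 0 1 with hF
  have hloc : IsLocalObservable F := ⟨_, isCylinder_plaquetteObs_zero (fundamentalRep (Fin 2)) 0 1⟩
  have hFm : Measurable F := measurable_plaquetteObs _ hρc 0 0 1
  have hFb : ∃ C, ∀ U, |F U| ≤ C := ⟨2, fun U => by simpa using abs_plaquetteObs_le_holds (fundamentalRep (Fin 2)) fundamentalRep_mem_unitaryGroup 0 0 1 U⟩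
  have hFg : IsZdGaugeInvariant F := isZdGaugeInvariant_plaquetteObs (fundamentalRep (Fin 2)) 0 0 1
  -- almost-sure self-averaging under both states
  have hae : ∀ {c : ℝ} {ν : Measure (LGConfig 4 (SUN 2))}, |c| ≤ 9 / 50 → ν ∈ ymGibbsMeasures (d := 4) (fundamentalRep (Fin 2)) c →
      ∀ᵐ U ∂ν, Tendsto (fun n : ℕ => (∑ x ∈ siteBox 4 n, F (configShift x U)) / (siteBox 4 n).card) atTop (𝓝 (∫ U', F U' ∂ν)) := by
    intro c ν hc hν
    obtain ⟨ν', hν1, hν'⟩ := ErgodicAverages.su2_wilson_ae_tendsto_boxAverage hc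
    have hνν : ν = ν' := by rw [hν1] at hν; exact Set.mem_singleton_iff.1 hν
    rw [hνν]
    exact (hν' F hloc hFm hFb hFg).1
  have ha₀ := hae (c := 0) (by rw [abs_zero]; norm_num) hμ₀
  have ha := hae (c := b) (abs_le.2 ⟨by linarith, by linarith⟩) hμ
  -- a DLR selection through `μ₀` at `0`; monotone on `[0, b/2]`, strictly increasing on `[b/2, b]`
  obtain ⟨ν, hν⟩ := CouplingResponse.exists_dlrSelection_dim (d := 4) (N := 2)
  set sel : ℝ → Measure (LGConfig 4 (SUN 2)) := fun t => if t = 0 then μ₀ else ν t with hsel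
  have hsel' : ∀ t ∈ Set.Icc (0 : ℝ) (9 / 50), sel t ∈ ymGibbsMeasures (d := 4) (fundamentalRep (Fin 2)) t := by
    intro t _
    by_cases ht : t = 0
    · rw [hsel]; dsimp only; rw [if_pos ht, ht]; exact hμ₀
    · rw [hsel]; dsimp only; rw [if_neg ht]; exact hν t
  have hmono := PressureRegularity.su2_plaquette_monotoneOn hsel' (((0 : Site 4), ⟨((0 : Fin 4), (1 : Fin 4)), by decide⟩) : ZdPlaquette 4)
  have h01 : ∫ U, F U ∂μ₀ ≤ ∫ U, F U ∂(ν (b / 2)) := by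
    have h := hmono (a := 0) ⟨le_rfl, by norm_num⟩ (b := b / 2) ⟨by linarith, by linarith⟩ (by linarith)
    have hb2 : b / 2 ≠ 0 := by linarith
    simp only [hsel, if_pos rfl, if_neg hb2] at h
    exact h
  have hinc := EnergyVariance.su2_plaquette_increment_ge (β₁ := b / 2) (β₂ := b) (by linarith) (by linarith) hb (hν (b / 2)) hμ
  have hpos : 0 < Real.exp (-(48 * b)) / 24 * (b - b / 2) := mul_pos (by positivity) (by linarith)
  have e₁ : ∫ U, F U ∂(ν (b / 2)) = 2 * ∫ U, zdPlaquetteObs (fundamentalRep (Fin 2)) 0 0 1 U ∂(ν (b / 2)) := by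
    simpa using PressureRegularity.integral_plaquetteObs_eq_mul (((0 : Site 4), ⟨((0 : Fin 4), (1 : Fin 4)), by decide⟩) : ZdPlaquette 4) (ν (b / 2))
  have e₂ : ∫ U, F U ∂μ = 2 * ∫ U, zdPlaquetteObs (fundamentalRep (Fin 2)) 0 0 1 U ∂μ := by
    simpa using PressureRegularity.integral_plaquetteObs_eq_mul (((0 : Site 4), ⟨((0 : Fin 4), (1 : Fin 4)), by decide⟩) : ZdPlaquette 4) μ
  have hne : ∫ U, F U ∂μ₀ ≠ ∫ U, F U ∂μ := by
    intro h
    rw [e₁] at h01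
    rw [e₂] at h
    linarith
  -- the two almost-sure limits separate the states
  refine Measure.MutuallySingular.mk (ae_iff.1 ha₀) (ae_iff.1 ha) fun U _ => ?_
  by_contra h
  simp only [Set.mem_union, Set.mem_setOf_eq, not_or, not_not] at h
  exact hne (tendsto_nhds_unique h.1 h.2)

end SU2

/-! ### Every `SU(N)`, every `d ≥ 2` -/

section SUN

variable {d N : ℕ}

/-- ★★★ **THE STRONG-COUPLING `SU(N)` STATE IS SINGULAR WITH RESPECT TO THE FREE STATE, EVERY `N ≥ 2`, EVERY `d ≥ 2`** ('t Hooft coupling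
`0 < β < min(1/(12(d−1)), 1/(8d))`; `μ₀` any DLR state at coupling `0`, `μ` any DLR state at the tree coupling `Nβ`, each unique): `μ₀ ⟂ₘ μ` —
HYPOTHESIS-FREE. [folklore] -/
theorem suN_state_mutuallySingular_zero_dim [NeZero d] (hd : 2 ≤ d) (hN : 2 ≤ N) {β : ℝ} (hβ0 : 0 < β)
    (hβ : β < 1 / (12 * ((d : ℝ) - 1))) (hβ' : β < 1 / (8 * (d : ℝ)))
    {μ₀ μ : Measure (LGConfig d (SUN N))} (hμ₀ : μ₀ ∈ ymGibbsMeasures (d := d) (fundamentalRep (Fin N)) 0)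
    (hμ : μ ∈ ymGibbsMeasures (d := d) (fundamentalRep (Fin N)) (N * β)) : μ₀ ⟂ₘ μ := by
  classical
  haveI : SecondCountableTopology (Matrix.specialUnitaryGroup (Fin N) ℂ) :=
    haveI : SecondCountableTopology (Matrix (Fin N) (Fin N) ℂ) := inferInstanceAs (SecondCountableTopology (Fin N → Fin N → ℂ))
    Topology.IsEmbedding.subtypeVal.secondCountableTopology
  have hρc : Continuous (fundamentalRep (Fin N)) := continuous_fundamentalRep (Fin N)
  have hG₀ : IsGibbsMeasure (ymSpecification (d := d) (fundamentalRep (Fin N)) 0) μ₀ := hμ₀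
  have hG : IsGibbsMeasure (ymSpecification (d := d) (fundamentalRep (Fin N)) (N * β)) μ := hμ
  haveI := hG₀.isProbabilityMeasure
  haveI := hG.isProbabilityMeasure
  have hN0 : (0 : ℝ) < N := by exact_mod_cast (show 0 < N by omega)
  set i0 : Fin d := ⟨0, by omega⟩ with hi0
  set j1 : Fin d := ⟨1, by omega⟩ with hj1
  have hij : i0 < j1 := by simp [hi0, hj1, Fin.lt_def]
  set F : LGConfig d (SUN N) → ℝ := plaquetteObs (fundamentalRep (Fin N)) 0 i0 j1 with hF
  have hloc : IsLocalObservable F := ⟨_, isCylinder_plaquetteObs_zero (fundamentalRep (Fin N)) i0 j1⟩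
  have hFm : Measurable F := measurable_plaquetteObs _ hρc 0 i0 j1
  have hFb : ∀ U, |F U| ≤ N := fun U => abs_plaquetteObs_le_holds (fundamentalRep (Fin N)) fundamentalRep_mem_unitaryGroup 0 i0 j1 U
  -- almost-sure self-averaging under THE state at every 't Hooft coupling of the sharp window
  have hae : ∀ {c : ℝ} {ν : Measure (LGConfig d (SUN N))}, |c| < HessianSharp.sharpThresholdSU d →
      ν ∈ ymGibbsMeasures (d := d) (fundamentalRep (Fin N)) (N * c) → IsProbabilityMeasure ν →
      ∀ᵐ U ∂ν, Tendsto (fun n : ℕ => (∑ x ∈ siteBox d n, F (configShift x U)) / (siteBox d n).card) atTop (𝓝 (∫ U', F U' ∂ν)) := by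
    intro c ν hc hν _
    obtain ⟨ν', h1, -, hinv, -⟩ := suN_wilson_oneState_symmetric_sharp hd hN hc
    have hνν : ν = ν' := by rw [h1] at hν; exact Set.mem_singleton_iff.1 hν
    rw [← hνν] at hinv
    obtain ⟨cc, hcc, hcl⟩ := (SharpUniquenessJoin.massGapAt_sharp_free hd hN hc).2 ν hν
    obtain ⟨C₀, hC₀⟩ := MassGapMassive.covariance_decay_of_lipschitzClustering (by omega) (by omega) (N * c) hν hcc hcl F F hloc hloc hFm hFm
      ⟨N, hFb⟩ ⟨N, hFb⟩
    exact ErgodicAverages.ae_tendsto_boxAverage hd hinv hFm hFb (ThermodynamicVariance.summable_abs_of_exp_decay (by omega) hcc hC₀)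
  have hβs : |β| < HessianSharp.sharpThresholdSU d := by rw [abs_of_nonneg hβ0.le]; exact hβ'
  have h0s : |(0 : ℝ)| < HessianSharp.sharpThresholdSU d := by
    rw [abs_zero]; exact lt_of_le_of_lt (abs_nonneg β) hβs
  have hμ₀' : μ₀ ∈ ymGibbsMeasures (d := d) (fundamentalRep (Fin N)) (N * 0) := by rw [mul_zero]; exact hμ₀
  have ha₀ := hae h0s hμ₀' inferInstance
  have ha := hae hβs hμ inferInstance
  -- a DLR selection through `μ₀` at `0`; monotone on `[0, Nβ/2]`, strictly increasing on `[Nβ/2, Nβ]`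
  obtain ⟨ν, hν⟩ := CouplingResponse.exists_dlrSelection_dim (d := d) (N := N)
  set sel : ℝ → Measure (LGConfig d (SUN N)) := fun t => if t = 0 then μ₀ else ν t with hsel
  have hsel' : ∀ t ∈ Set.Icc (0 : ℝ) ((N : ℝ) / (12 * ((d : ℝ) - 1))), sel t ∈ ymGibbsMeasures (d := d) (fundamentalRep (Fin N)) t := by
    intro t _
    by_cases ht : t = 0
    · rw [hsel]; dsimp only; rw [if_pos ht, ht]; exact hμ₀
    · rw [hsel]; dsimp only; rw [if_neg ht]; exact hν t
  have hd1 : (0 : ℝ) < 12 * ((d : ℝ) - 1) := by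
    have : (2 : ℝ) ≤ d := by exact_mod_cast hd
    linarith
  have hbw : (N : ℝ) * β < (N : ℝ) / (12 * ((d : ℝ) - 1)) := by
    rw [lt_div_iff₀ hd1]
    have := (lt_div_iff₀ hd1).1 hβ
    nlinarith
  have hmono := PressureRegularity.plaquette_monotoneOn_dim_thooft hd hN hsel' (((0 : Site d), ⟨(i0, j1), hij⟩) : ZdPlaquette d)
  have hNβ0 : 0 ≤ (N : ℝ) * β := by positivity
  have h01 : ∫ U, zdPlaquetteObs (fundamentalRep (Fin N)) 0 i0 j1 U ∂μ₀ ≤ ∫ U, zdPlaquetteObs (fundamentalRep (Fin N)) 0 i0 j1 U ∂(ν (N * β / 2)) := by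
    have h := hmono (a := 0) ⟨le_rfl, by positivity⟩ (b := N * β / 2) ⟨by positivity, by linarith⟩ (by positivity)
    have hb2 : (N : ℝ) * β / 2 ≠ 0 := by positivity
    simp only [hsel, if_pos rfl, if_neg hb2] at h
    exact h
  have hinc := EnergyVariance.plaquette_increment_ge_dim_thooft hd hN (b₁ := N * β / 2) (b₂ := N * β) (by positivity) (by nlinarith) hbw
    (hν (N * β / 2)) hμ
  have hV : 0 < Literature.MathematicalPhysics.QuantumFieldTheory.PlaquetteLowerBound.charVariance (fundamentalRep (Fin N)) :=
    Literature.MathematicalPhysics.QuantumFieldTheory.PlaquetteLowerBound.charVariance_pos _ hρc (by omega)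
  have hpos : 0 < (1 / 2 : ℝ) * Real.exp (-(8 * (d - 1 : ℕ) * N * (N * β))) *
      Literature.MathematicalPhysics.QuantumFieldTheory.PlaquetteLowerBound.charVariance (fundamentalRep (Fin N)) * (N * β - N * β / 2) := by
    have : 0 < (N : ℝ) * β - N * β / 2 := by nlinarith
    positivity
  have hplpos : (0 : ℝ) < Fintype.card {q : Fin d × Fin d // q.1 < q.2} := by
    have : Nonempty {q : Fin d × Fin d // q.1 < q.2} := ⟨⟨(i0, j1), hij⟩⟩
    exact_mod_cast Fintype.card_pos
  have hlt : ∫ U, zdPlaquetteObs (fundamentalRep (Fin N)) 0 i0 j1 U ∂(ν (N * β / 2)) < ∫ U, zdPlaquetteObs (fundamentalRep (Fin N)) 0 i0 j1 U ∂μ := by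
    by_contra hge
    have hge' := not_lt.1 hge
    have : (Fintype.card {q : Fin d × Fin d // q.1 < q.2} : ℝ) * N *
        ((∫ U, zdPlaquetteObs (fundamentalRep (Fin N)) 0 i0 j1 U ∂μ) - ∫ U, zdPlaquetteObs (fundamentalRep (Fin N)) 0 i0 j1 U ∂(ν (N * β / 2))) ≤ 0 :=
      mul_nonpos_of_nonneg_of_nonpos (by positivity) (by linarith)
    linarith
  have e₀ : ∫ U, F U ∂μ₀ = N * ∫ U, zdPlaquetteObs (fundamentalRep (Fin N)) 0 i0 j1 U ∂μ₀ :=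
    PressureRegularity.integral_plaquetteObs_eq_mul (((0 : Site d), ⟨(i0, j1), hij⟩) : ZdPlaquette d) μ₀
  have e₂ : ∫ U, F U ∂μ = N * ∫ U, zdPlaquetteObs (fundamentalRep (Fin N)) 0 i0 j1 U ∂μ :=
    PressureRegularity.integral_plaquetteObs_eq_mul (((0 : Site d), ⟨(i0, j1), hij⟩) : ZdPlaquette d) μ
  have hne : ∫ U, F U ∂μ₀ ≠ ∫ U, F U ∂μ := by
    rw [e₀, e₂]
    intro h
    have h' := mul_left_cancel₀ hN0.ne' h
    linarith
  refine Measure.MutuallySingular.mk (ae_iff.1 ha₀) (ae_iff.1 ha) fun U _ => ?_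
  by_contra h
  simp only [Set.mem_union, Set.mem_setOf_eq, not_or, not_not] at h
  exact hne (tendsto_nhds_unique h.1 h.2)

end SUN

end BoundaryFreeEnergy

end Summit.Ventures.YMGap.RobustBall

end
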